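import Mathlib.Analysis.Matrix.PosDef
import Mathlib.Analysis.Matrix.Spectrum
import Summits.Ventures.HodgeRepro2.UnitaryReflection

/-!
# Definiteness at one place makes the hermitian space anisotropic

For the hermitian form `H` of the record (`IsHermitianForm K H`, signature `(2,1)` at `τ₁` and
definite at every other complex embedding), a CM field `K` of degree `> 2` has an embedding `τ`
with `mk τ ≠ mk τ₁`, where `H` is definite; then `τ(v* H v) = ⟨τv, τ(H) τv⟩` is a non-zero real
number for every `v ≠ 0`, so `v* H v ≠ 0`: the hermitian space `(K³, H)` is ANISOTROPIC.  This is the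
hypothesis of Godement's compactness criterion (the quotient `Γ₁\𝔹²` is compact because `U(H)` is
`ℚ`-anisotropic) — stated here in kernel at the level of the form; the criterion itself stays
prose.  A by-product: every non-zero `v ∈ K³` gives a unitary reflection (`UnitaryReflection.lean`).

Ingredients: `τ ∘ ρ = conj ∘ τ` (`NumberField.IsCMField.complexEmbedding_complexConj`), the
eigenvalue count of `signatureAt`, and Mathlib's `IsHermitian.posDef_iff_eigenvalues_pos` /
`PosDef.re_dotProduct_pos`.
-/

namespace Summit.Ventures.HodgeRepro2.ShimuraData

open Matrix NumberField
open scoped ComplexOrder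

variable {K : Type*} [Field K] [NumberField K] [NumberField.IsCMField K] {m : ℕ}

/-- `τ (x* H y) = ⟨τ x, τ(H) (τ y)⟩` — the complex hermitian inner product of the embedded
vectors, for every complex embedding `τ` of the CM field (`τ ∘ ρ = conj ∘ τ`). -/
lemma map_hermDot (τ : K →+* ℂ) (H : Matrix (Fin m) (Fin m) K) (x y : Fin m → K) :
    τ (hermDot H x y) = star (⇑τ ∘ x) ⬝ᵥ ((H.map ⇑τ) *ᵥ (⇑τ ∘ y)) := by
  unfold hermDot
  rw [RingHom.map_dotProduct]
  congr 1
  · funext i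
    simp only [Function.comp_apply, Pi.star_apply, Complex.star_def, ρ]
    exact NumberField.IsCMField.complexEmbedding_complexConj K τ (x i)
  · funext i
    exact RingHom.map_mulVec τ H y i

omit [NumberField K] [NumberField.IsCMField K] in
/-- A hermitian complex matrix with negative eigenvalues is negative definite. -/
lemma neg_posDef_of_eigenvalues_neg {n : Type*} [Fintype n] [DecidableEq n] {A : Matrix n n ℂ}
    (hA : A.IsHermitian) (h : ∀ i, hA.eigenvalues i < 0) : (-A).PosDef := by
  rw [hA.spectral_theorem, ← map_neg, diagonal_neg, Unitary.conjStarAlgAut_apply,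
    Unitary.isUnit_coe.posDef_star_right_conjugate_iff, posDef_diagonal_iff]
  intro i
  simp only [Function.comp_apply, Left.neg_pos_iff]
  exact RCLike.ofReal_lt_zero.mpr (h i)

/-- Signature `(m, 0)` at `τ` means `τ(H)` is positive definite. -/
lemma posDef_map_of_signatureAt_eq_left {τ : K →+* ℂ} {H : Matrix (Fin m) (Fin m) K}
    (hH : IsHermitianForm K H) (hs : signatureAt K τ H = (m, 0)) : (H.map ⇑τ).PosDef := by
  have hh := isHermitian_map_of_isHermitianForm hH τ
  unfold signatureAt at hs
  rw [dif_pos hh, Prod.mk.injEq] at hs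
  rw [hh.posDef_iff_eigenvalues_pos]
  have huniv : ({i | 0 < hh.eigenvalues i} : Finset (Fin m)) = Finset.univ := by
    rw [← Finset.card_eq_iff_eq_univ, hs.1, Fintype.card_fin]
  intro i
  have := Finset.eq_univ_iff_forall.mp huniv i
  simpa using this

/-- Signature `(0, m)` at `τ` means `τ(H)` is negative definite. -/
lemma neg_posDef_map_of_signatureAt_eq_right {τ : K →+* ℂ} {H : Matrix (Fin m) (Fin m) K}
    (hH : IsHermitianForm K H) (hs : signatureAt K τ H = (0, m)) : (-(H.map ⇑τ)).PosDef := by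
  have hh := isHermitian_map_of_isHermitianForm hH τ
  unfold signatureAt at hs
  rw [dif_pos hh, Prod.mk.injEq] at hs
  apply neg_posDef_of_eigenvalues_neg hh
  have huniv : ({i | hh.eigenvalues i < 0} : Finset (Fin m)) = Finset.univ := by
    rw [← Finset.card_eq_iff_eq_univ, hs.2, Fintype.card_fin]
  intro i
  have := Finset.eq_univ_iff_forall.mp huniv i
  simpa using this

/-- **Definiteness at one embedding ⇒ no isotropic vectors**: if `H` is definite at `τ` then
`v* H v ≠ 0` for every `v ≠ 0`. -/
theorem hermDot_self_ne_zero_of_isDefiniteAt {τ : K →+* ℂ} {H : Matrix (Fin m) (Fin m) K}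
    (hH : IsHermitianForm K H) (hdef : IsDefiniteAt K τ H) {v : Fin m → K} (hv : v ≠ 0) :
    hermDot H v v ≠ 0 := by
  intro h0
  have hτv : (⇑τ ∘ v) ≠ 0 := by
    intro h
    apply hv
    funext i
    have := congrFun h i
    simpa using this
  have key := map_hermDot τ H v v
  rw [h0, map_zero] at key
  rcases hdef with hs | hs
  · have hp := posDef_map_of_signatureAt_eq_left hH hs
    have := hp.re_dotProduct_pos hτv
    rw [← key] at this
    simp at this
  · have hp := neg_posDef_map_of_signatureAt_eq_right hH hs
    have := hp.re_dotProduct_pos hτv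
    rw [neg_mulVec, dotProduct_neg, ← key] at this
    simp at this

/-- The hermitian space `(K^m, H)` is anisotropic: `v* H v = 0` only for `v = 0`. -/
def IsAnisotropic (H : Matrix (Fin m) (Fin m) K) : Prop :=
  ∀ v : Fin m → K, hermDot H v v = 0 → v = 0

/-- Definite at one embedding ⇒ anisotropic. -/
theorem isAnisotropic_of_isDefiniteAt {τ : K →+* ℂ} {H : Matrix (Fin m) (Fin m) K}
    (hH : IsHermitianForm K H) (hdef : IsDefiniteAt K τ H) : IsAnisotropic H :=
  fun v hv => by
    by_contra hne
    exact hermDot_self_ne_zero_of_isDefiniteAt hH hdef hne hv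

/-- A CM field of degree `> 2` has an infinite place different from any given one. -/
theorem exists_infinitePlace_ne_of_two_lt_finrank (h : 2 < Module.finrank ℚ K) (τ₁ : K →+* ℂ) :
    ∃ τ : K →+* ℂ, InfinitePlace.mk τ ≠ InfinitePlace.mk τ₁ := by
  have hcard : 1 < Fintype.card (InfinitePlace K) := by
    rw [InfinitePlace.card_eq_nrRealPlaces_add_nrComplexPlaces,
      IsTotallyComplex.nrRealPlaces_eq_zero K, zero_add]
    have := IsTotallyComplex.finrank K
    omega
  obtain ⟨w, hw⟩ := Fintype.exists_ne_of_one_lt_card hcard (InfinitePlace.mk τ₁)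
  exact ⟨w.embedding, by rw [InfinitePlace.mk_embedding]; exact hw⟩

/-- **The record's hermitian space is anisotropic** when `[K : ℚ] > 2`: a form of signature
`(n, 1)` at `τ₁` that is definite at every other embedding (`IsPicardSignature`'s second clause) has
no isotropic vector — the hypothesis of Godement's compactness criterion for `Γ₁\𝔹²`. -/
theorem isAnisotropic_of_two_lt_finrank {τ₁ : K →+* ℂ} {H : Matrix (Fin m) (Fin m) K}
    (hH : IsHermitianForm K H)
    (hdef : ∀ τ : K →+* ℂ, InfinitePlace.mk τ ≠ InfinitePlace.mk τ₁ → IsDefiniteAt K τ H)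
    (h : 2 < Module.finrank ℚ K) : IsAnisotropic H := by
  obtain ⟨τ, hτ⟩ := exists_infinitePlace_ne_of_two_lt_finrank h τ₁
  exact isAnisotropic_of_isDefiniteAt hH (hdef τ hτ)

/-- In the anisotropic case EVERY non-zero vector carries a unitary reflection: `r_v ∈ U(H)(K)`,
`r_v² = 1`, `r_v v = −v`. -/
theorem reflectionGL_mem_unitaryGroup_of_isAnisotropic {H : Matrix (Fin m) (Fin m) K}
    (hH : IsHermitianForm K H) (ha : IsAnisotropic H) {v : Fin m → K} (hv : v ≠ 0) :
    reflectionGL H v (fun h => hv (ha v h)) ∈ unitaryGroup K H :=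
  reflectionGL_mem_unitaryGroup hH _

/-- In the anisotropic case on `K³`, every non-zero `v` gives `−r_v ∈ SU(H)(K)`, an involution
`≠ 1` (the element used for the self-adjoint Hecke operator of `SelfAdjointHeckeInvolution.lean`). -/
theorem neg_reflectionGL_mem_specialUnitaryGroup_of_isAnisotropic {H : Matrix (Fin 3) (Fin 3) K}
    (hH : IsHermitianForm K H) (ha : IsAnisotropic H) {v : Fin 3 → K} (hv : v ≠ 0) :
    -reflectionGL H v (fun h => hv (ha v h)) ∈ specialUnitaryGroup K H ∧
      -reflectionGL H v (fun h => hv (ha v h)) ≠ 1 :=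
  ⟨neg_reflectionGL_mem_specialUnitaryGroup hH _, neg_reflectionGL_ne_one _ (by decide)⟩

end Summit.Ventures.HodgeRepro2.ShimuraData
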